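import Summits.Schanuel.Schanuel.Theorems.DiophantineDichotomyApproximationPropertyCycleAPIAt3OrbitFloor
import HarnessLib

/-!
# Stub `orbitFloorLog` (skeleton v12; crux `ApproximationProperty`, stmt-Schanuel-6117) from the log-free orbit floor

Crux `stmt-Schanuel-6117` (`Summit.Schanuel.Schanuel.Theses.DiophantineDichotomy.ApproximationProperty`),
line `orbit-interpolation-determinant`, skeleton v12 of lead c5
(`Cruxes/ApproximationProperty/Lines/orbit_interpolation_determinant.lean`). This file PROVES the
registered stub `orbitFloorLog` — the orbit floor in LOG form, with an extra `deg 𝔭 · log(L + 2)` term —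
as an immediate weakening of the LOG-FREE floor `stub_orbitFloor : OrbitFloor` landed in
`…CycleAPIAt3OrbitFloor.lean` (dictionary (D) + coordinate chart + fibre bound + clean cluster lever
on the primitive integer minimal polynomial, `log M = deg · h_K / D` by the tree's Mahler–Weil bridge
`MahlerWeil.weilHeight₁_root_eq`, + dyadic layer cake). The local instance below is the grading of
`ℚ[x₀, …, x₃]` by degree, needed only to STATE homogeneity exactly as the skeleton does.

Sources: NesterenkoPhilippon2001 (LNM 1752) Ch. 3 §4; the stub plan `STUB-PLAN-CycleAPIAt3.md` P2.
-/

noncomputable section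

-- `Summit.Schanuel.Schanuel.…` is the mandated summit/sub-problem namespace (single-conjunct summit), hence:
set_option linter.dupNamespace false

attribute [local instance] MvPolynomial.gradedAlgebra

namespace Summit.Schanuel.Schanuel.Cruxes.ApproximationProperty.OrbitInterpolationDeterminant

open Literature.NumberTheory.Transcendental.Nesterenko MvPolynomial
open scoped BigOperators

/-- **Registered skeleton stub `orbitFloorLog`** (skeleton v12 of lead c5: the orbit floor in LOG form,
with an extra `deg 𝔭 · log(L+2)` term on the right) — an immediate consequence of the log-free
`stub_orbitFloor`, which it weakens. [cite: NesterenkoPhilippon2001, Ch. 3 §4 (Prop. 4.4, 4.7, 4.11)] -/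
theorem orbitFloorLog : ∀ ω : Fin 3 → ℂ, ∃ C : ℝ, 0 < C ∧ ∀ (𝔭 𝔮 : Ideal (Rx 3)) (L : ℝ), 𝔭.IsPrime → 𝔭.IsHomogeneous (homogeneousSubmodule (Fin (3 + 1)) ℚ) → IsUnmixedOfRank 𝔭 1 → 𝔮.IsPrime → 𝔮.IsHomogeneous (homogeneousSubmodule (Fin (3 + 1)) ℚ) → IsUnmixedOfRank 𝔮 2 → 𝔮 ≤ 𝔭 → 1 ≤ L → (∀ β ∈ projZeros 𝔭, Real.exp (-L) ≤ projDist (Fin.cons 1 ω) β) → Real.log (1 / iabs 𝔭 1 (Fin.cons 1 ω)) ≤ C * ((ideg 𝔮 2 : ℝ) * L + iheight 𝔭 1 + (ideg 𝔭 1 : ℝ) * Real.log ((ideg 𝔭 1 : ℝ) + 2) + (ideg 𝔭 1 : ℝ) * Real.log (L + 2) + Real.sqrt ((ideg 𝔭 1 : ℝ) * (iheight 𝔭 1 + ideg 𝔭 1 + (ideg 𝔮 2 : ℝ) * Real.log ((ideg 𝔭 1 : ℝ) + 2)) * L)) := by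
  intro ω
  obtain ⟨C, hC, h⟩ := stub_orbitFloor ω
  refine ⟨C, hC, fun 𝔭 𝔮 L h𝔭 h𝔭hom h𝔭unm h𝔮 h𝔮hom h𝔮unm hle hL hfar => ?_⟩
  refine (h 𝔭 𝔮 L h𝔭 h𝔭hom h𝔭unm h𝔮 h𝔮hom h𝔮unm hle hL hfar).trans ?_
  refine mul_le_mul_of_nonneg_left ?_ hC.le
  have h0 : 0 ≤ (ideg 𝔭 1 : ℝ) * Real.log (L + 2) :=
    mul_nonneg (Nat.cast_nonneg _) (Real.log_nonneg (by linarith))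
  linarith

end Summit.Schanuel.Schanuel.Cruxes.ApproximationProperty.OrbitInterpolationDeterminant

end
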